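import Literature.Analysis.Convolution.ScaledMollifier
import Mathlib.Topology.UniformSpace.HeineCantor
import HarnessLib

/-!
# Mollification approximates a compactly supported `C²` function in `C²`, uniformly

Topic `Analysis/Convolution`. Theorem file (no definitions, no named facts; everything proved):
Evans, *PDE*, App. C.4, Theorem 7 (iii)–(iv) ("if `f ∈ C(U)` then `f^ε → f` uniformly on compact
subsets; `D^α f^ε = η_ε * D^α f`"), in the form: for `V ∈ C²_c(E)` and `η > 0` there is `δ > 0`
with `‖J_δ V - V‖, ‖D(J_δ V) - DV‖, ‖D²(J_δ V) - D²V‖ ≤ η` everywhere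
(`exists_mollify_contDiff_two_approx`), together with the smoothness, compact support and support
control of `J_δ V`. Used on the discharge path of
`Literature.Geometry.Riemannian.sharpLogSobolevAVR_four` (smoothing a `C²` solution of the Neumann
problem).

## References

* L. C. Evans, *Partial Differential Equations*, 2nd ed. (2010), App. C.4 Theorem 7. [Evans2010]
-/

noncomputable section

open MeasureTheory Set Function Filter Metric Module ContinuousLinearMap
open scoped Convolution ContDiff Topology Pointwise

namespace Literature.Analysis.Convolution

variable {E : Type*} [NormedAddCommGroup E] [InnerProductSpace ℝ E] [FiniteDimensional ℝ E]
  [MeasurableSpace E] [BorelSpace E]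
variable {F : Type*} [NormedAddCommGroup F] [NormedSpace ℝ F] [CompleteSpace F]

/-- **Uniform approximation by mollification** for a continuous compactly supported function
(vector-valued): `‖J_δ k - k‖_∞ ≤ η` for small `δ`. [cite: Evans2010, App. C.4 Theorem 7 (iii)] -/
theorem exists_forall_dist_mollify_le {k : E → F} (hk : Continuous k) (hkc : HasCompactSupport k)
    {η : ℝ} (hη : 0 < η) :
    ∃ δ₀ : ℝ, 0 < δ₀ ∧ ∀ δ, 0 < δ → δ ≤ δ₀ → ∀ x, dist (mollify δ k x) (k x) ≤ η := by
  have huc : UniformContinuous k := hkc.uniformContinuous_of_continuous hk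
  obtain ⟨τ, hτ, hτk⟩ := Metric.uniformContinuous_iff.1 huc η hη
  refine ⟨τ / 4, by positivity, fun δ hδ hδτ x ↦ ?_⟩
  refine dist_mollify_le hδ hk.aestronglyMeasurable fun y hy ↦ ?_
  rw [mem_ball] at hy
  exact (hτk (by linarith)).le

omit [CompleteSpace F] in
/-- Mollification commutes with the evaluation of operator-valued functions. [folklore] -/
theorem mollify_clm_apply {G : Type*} [NormedAddCommGroup G] [NormedSpace ℝ G] [CompleteSpace G]
    (δ : ℝ) {k : E → F →L[ℝ] G} (hk : Continuous k) (hkc : HasCompactSupport k) (x : E) (a : F) :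
    mollify δ k x a = mollify δ (fun y ↦ k y a) x := by
  rw [mollify_apply', mollify_apply']
  have hc : Continuous fun y ↦ mollifier δ (x - y) • k y :=
    ((continuous_mollifier δ).comp (continuous_const.sub continuous_id)).smul hk
  have hs : HasCompactSupport fun y ↦ mollifier δ (x - y) • k y := by
    refine hkc.mono fun y hy ↦ ?_
    intro h0; apply hy
    show mollifier δ (x - y) • k y = 0
    rw [h0, smul_zero]
  have hint : Integrable (fun y ↦ mollifier δ (x - y) • k y) volume :=
    hc.integrable_of_hasCompactSupport hs
  rw [ContinuousLinearMap.integral_apply hint a]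
  refine integral_congr_ae (ae_of_all _ fun y ↦ ?_)
  simp only [FunLike.coe_smul, Pi.smul_apply]

omit [CompleteSpace F] in
/-- **`D(J_δ V) = J_δ(DV)`** for `V ∈ C¹_c` (as operator-valued functions).
[cite: Evans2010, App. C.4 Theorem 7 (iv)] -/
theorem fderiv_mollify_eq_mollify_fderiv [CompleteSpace F] (δ : ℝ) {V : E → F} (hV : ContDiff ℝ 1 V)
    (hVc : HasCompactSupport V) : fderiv ℝ (mollify δ V) = mollify δ (fderiv ℝ V) := by
  funext x
  ext a
  rw [fderiv_mollify_apply_eq_mollify δ hV hVc x a,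
    mollify_clm_apply δ (hV.continuous_fderiv one_ne_zero) (hVc.fderiv ℝ) x a]

/-- **`C²`-approximation by mollification** (Evans, App. C.4 Thm. 7): for `V ∈ C²_c(E)` and
`η > 0` there is `δ > 0` such that `J_δ V` is smooth with compact support inside the
`2δ`-neighbourhood of `tsupport V`, and `J_δ V - V` together with its first two derivatives is
bounded by `η` everywhere. [cite: Evans2010, App. C.4 Theorem 7] -/
theorem exists_mollify_contDiff_two_approx {V : E → ℝ} (hV : ContDiff ℝ 2 V)
    (hVc : HasCompactSupport V) {η : ℝ} (hη : 0 < η) {U : Set E} (hU : IsOpen U)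
    (hVU : tsupport V ⊆ U) :
    ∃ (δ : ℝ) (W : E → ℝ), 0 < δ ∧ W = mollify δ V ∧ ContDiff ℝ ∞ W ∧ HasCompactSupport W ∧
      tsupport W ⊆ U ∧
      (∀ x, |W x - V x| ≤ η) ∧ (∀ x, ‖fderiv ℝ W x - fderiv ℝ V x‖ ≤ η) ∧
      (∀ x, ‖fderiv ℝ (fderiv ℝ W) x - fderiv ℝ (fderiv ℝ V) x‖ ≤ η) := by
  have hV1 : ContDiff ℝ 1 V := hV.of_le (by norm_cast)
  have hDV : ContDiff ℝ 1 (fderiv ℝ V) := hV.fderiv_right (by norm_cast)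
  have hDVc : HasCompactSupport (fderiv ℝ V) := hVc.fderiv ℝ
  have hD2Vc : HasCompactSupport (fderiv ℝ (fderiv ℝ V)) := hDVc.fderiv ℝ
  -- uniform continuity moduli
  obtain ⟨δ₁, hδ₁, h₁⟩ := exists_forall_dist_mollify_le hV.continuous hVc hη
  obtain ⟨δ₂, hδ₂, h₂⟩ := exists_forall_dist_mollify_le hDV.continuous hDVc hη
  obtain ⟨δ₃, hδ₃, h₃⟩ := exists_forall_dist_mollify_le (hDV.continuous_fderiv one_ne_zero) hD2Vc hη
  -- a margin keeping the support inside `U`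
  obtain ⟨τ, hτ, hτU⟩ : ∃ τ > 0, cthickening τ (tsupport V) ⊆ U :=
    hVc.isCompact.exists_cthickening_subset_open hU hVU
  set δ : ℝ := min (min δ₁ δ₂) (min δ₃ (τ / 4)) with hδ_def
  have hδ : 0 < δ := by positivity
  have hδ1 : δ ≤ δ₁ := (min_le_left _ _).trans (min_le_left _ _)
  have hδ2 : δ ≤ δ₂ := (min_le_left _ _).trans (min_le_right _ _)
  have hδ3 : δ ≤ δ₃ := (min_le_right _ _).trans (min_le_left _ _)
  have hδτ : δ ≤ τ / 4 := (min_le_right _ _).trans (min_le_right _ _)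
  have hloc : LocallyIntegrable V volume := hV.continuous.locallyIntegrable
  refine ⟨δ, mollify δ V, hδ, rfl, contDiff_mollify δ hloc, hasCompactSupport_mollify δ hVc, ?_,
    fun x ↦ ?_, fun x ↦ ?_, fun x ↦ ?_⟩
  · -- support
    refine (closure_minimal (fun x hx ↦ ?_) isClosed_cthickening).trans hτU
    by_contra hxτ
    apply hx
    refine mollify_eq_zero_of_ball hδ fun y hy ↦ image_eq_zero_of_notMem_tsupport fun hyV ↦ hxτ ?_
    rw [mem_cthickening_iff]
    refine (Metric.infEDist_le_edist_of_mem hyV).trans ?_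
    rw [edist_dist]
    have : dist x y < 2 * δ := by rw [dist_comm]; exact mem_ball.1 hy
    exact ENNReal.ofReal_le_ofReal (by linarith)
  · have := h₁ δ hδ hδ1 x
    rwa [Real.dist_eq] at this
  · have := h₂ δ hδ hδ2 x
    rw [dist_eq_norm, ← fderiv_mollify_eq_mollify_fderiv δ hV1 hVc] at this
    exact this
  · have := h₃ δ hδ hδ3 x
    rw [dist_eq_norm, ← fderiv_mollify_eq_mollify_fderiv δ hDV hDVc,
      ← fderiv_mollify_eq_mollify_fderiv δ hV1 hVc] at this
    exact this

end Literature.Analysis.Convolution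

end
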